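import Literature.Computability.AlgebraicComplexity.BigCwSquareComponents
import HarnessLib

/-!
# The value of the component `[112]` of `CW_q^{⊗2}` (Coppersmith–Winograd 1990, §8) — proved

Topic `Literature/Computability/AlgebraicComplexity`.  In Coppersmith–Winograd's analysis of
`CW_q^{⊗2}` (J. Symbolic Comput. 9 (1990), §8) the component `T^{[112]}` is not a matrix product;
its value is obtained by a second application of the laser construction (with the symmetrisation
`t ⊗ t_C ⊗ t_{C²}`) to its decomposition into the four products
`T_{110} ⊗ T_{002}`, `T_{002} ⊗ T_{110}` (`≅ ⟨q,1,1⟩`-type, volume `q`) and `T_{101} ⊗ T_{011}`,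
`T_{011} ⊗ T_{101}` (volume `q²`), printed as `V_τ([112]) ≥ 2^{2/3} q^τ (q^{3τ} + 2)^{1/3}`
(the maximum over the splitting parameter; Le Gall 2014, Table 2 lists the same values).  This file
PROVES, for every splitting parameter `σ ∈ (0,1)` (weight `σ` on the two volume-`q²` products), the
bound behind that formula:

* `cwS112`, `cwTight112`, `cwTight112γ`, `cwSqComp112_support` — the pair decomposition of `[112]`
  (support = the four pairs, tight in `ℤ²`);
* `cwP112 σ`, its marginals (`marginalDist₁₂₃_cwP112`: uniform on two `x`- and `y`-labels,
  `((1−σ)/2, (1−σ)/2, σ)` on the `z`-labels) and entropies, `maxEntropyPenalty_cwP112` (`Γ = 0`,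
  product form);
* `hasLaserValue_symm3_cwSqComp112` — **`V_ρ(T^{[112]})³ ≥ 2^{2 + H(σ, (1−σ)/2, (1−σ)/2)} · q^{ρ(1+σ)}`**
  in Le Gall's sense (`laserMethodSym_hasLaserValue`), i.e.
  `log₂ V_ρ([112]) ≥ (2 + (1−σ) + H₂(σ))/3 + (ρ/3)(1+σ) log₂ q`, whose maximum over `σ` is the
  printed `2^{2/3} q^{ρ/3} (q^ρ + 2)^{1/3}`; and the rotations `[121]`, `[211]`.

Everything is proved; definitions are the explicit data of the decomposition; no named facts.

## References

* D. Coppersmith, S. Winograd, J. Symbolic Comput. 9 (1990), §8 (value of `[112]`).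
  [CoppersmithWinograd1990]
* F. Le Gall, ISSAC 2014, arXiv:1401.7714, §5 and Table 2. [LeGall2014]
-/

noncomputable section

open scoped BigOperators
open Finset Real

namespace Literature.Computability.AlgebraicComplexity

universe u

/-! ## Marginals of finitely supported distributions -/

section Marginals

variable {ι κ μ : Type*} [Fintype ι] [Fintype κ] [Fintype μ] [DecidableEq ι] [DecidableEq κ]
  [DecidableEq μ]

omit [DecidableEq κ] [DecidableEq μ] in
/-- The first marginal of a distribution supported in `S` is a sum over a fibre of `S`. [folklore] -/
theorem marginalDist₁_eq_sum_filter (S : Finset (ι × κ × μ)) {P : ι × κ × μ → ℝ}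
    (hPS : ∀ s, s ∉ S → P s = 0) (x : ι) :
    marginalDist₁ P x = ∑ s ∈ S.filter (fun s => s.1 = x), P s := by
  rw [show marginalDist₁ P x = ∑ b, ∑ c, P (x, b, c) from rfl, ← sum_ite_fst_eq P x, ← Finset.sum_filter]
  exact (Finset.sum_subset (Finset.filter_subset_filter _ (Finset.subset_univ S)) fun s hs hs' =>
    hPS s fun h => hs' (Finset.mem_filter.2 ⟨h, (Finset.mem_filter.1 hs).2⟩)).symm

omit [DecidableEq ι] [DecidableEq μ] in
/-- The second marginal as a sum over a fibre of the support. [folklore] -/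
theorem marginalDist₂_eq_sum_filter (S : Finset (ι × κ × μ)) {P : ι × κ × μ → ℝ}
    (hPS : ∀ s, s ∉ S → P s = 0) (y : κ) :
    marginalDist₂ P y = ∑ s ∈ S.filter (fun s => s.2.1 = y), P s := by
  rw [show marginalDist₂ P y = ∑ a, ∑ c, P (a, y, c) from rfl, ← sum_ite_snd_fst_eq P y,
    ← Finset.sum_filter]
  exact (Finset.sum_subset (Finset.filter_subset_filter _ (Finset.subset_univ S)) fun s hs hs' =>
    hPS s fun h => hs' (Finset.mem_filter.2 ⟨h, (Finset.mem_filter.1 hs).2⟩)).symm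

omit [DecidableEq ι] [DecidableEq κ] in
/-- The third marginal as a sum over a fibre of the support. [folklore] -/
theorem marginalDist₃_eq_sum_filter (S : Finset (ι × κ × μ)) {P : ι × κ × μ → ℝ}
    (hPS : ∀ s, s ∉ S → P s = 0) (z : μ) :
    marginalDist₃ P z = ∑ s ∈ S.filter (fun s => s.2.2 = z), P s := by
  rw [show marginalDist₃ P z = ∑ a, ∑ b, P (a, b, z) from rfl, ← sum_ite_snd_snd_eq P z,
    ← Finset.sum_filter]
  exact (Finset.sum_subset (Finset.filter_subset_filter _ (Finset.subset_univ S)) fun s hs hs' =>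
    hPS s fun h => hs' (Finset.mem_filter.2 ⟨h, (Finset.mem_filter.1 hs).2⟩)).symm

end Marginals

/-! ## The pair decomposition of `[112]` -/

section Decomposition

/-- A pair label. [folklore] -/
abbrev PL := Fin 3 × Fin 3

/-- **The support of the pair decomposition of `T^{[112]}`**: the four pairs
`(110,002), (002,110), (101,011), (011,101)` written by coordinates
`((i,i'),(j,j'),(l,l'))`. [cite: CoppersmithWinograd1990, §8] -/
def cwS112 : Finset (PL × PL × PL) :=
  {((1, 0), (1, 0), (0, 2)), ((0, 1), (0, 1), (2, 0)), ((1, 0), (0, 1), (1, 1)), ((0, 1), (1, 0), (1, 1))}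

/-- Tightness vectors of the pair labels (first two coordinates): the pair itself. [folklore] -/
def cwTight112 (p : PL) : Fin 2 → ℤ := ![((p.1 : ℕ) : ℤ), ((p.2 : ℕ) : ℤ)]

/-- Tightness vectors (third coordinate): the pair minus `(2,2)`. [folklore] -/
def cwTight112γ (p : PL) : Fin 2 → ℤ := ![((p.1 : ℕ) : ℤ) - 2, ((p.2 : ℕ) : ℤ) - 2]

/-- `cwTight112` is injective. [folklore] -/
theorem cwTight112_injective : Function.Injective cwTight112 := by
  intro p p' h
  have h0 := congrFun h 0
  have h1 := congrFun h 1
  simp only [cwTight112, Matrix.cons_val_zero, Matrix.cons_val_one, Nat.cast_inj] at h0 h1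
  exact Prod.ext (Fin.ext h0) (Fin.ext h1)

/-- `cwTight112γ` is injective. [folklore] -/
theorem cwTight112γ_injective : Function.Injective cwTight112γ := by
  intro p p' h
  have h0 := congrFun h 0
  have h1 := congrFun h 1
  simp only [cwTight112γ, Matrix.cons_val_zero, Matrix.cons_val_one, sub_left_inj,
    Nat.cast_inj] at h0 h1
  exact Prod.ext (Fin.ext h0) (Fin.ext h1)

/-- `|cwTight112 p| ≤ 2`. [folklore] -/
theorem cwTight112_bound (p : PL) (k : Fin 2) : |cwTight112 p k| ≤ (2 : ℕ) := by
  have h1 := p.1.isLt; have h2 := p.2.isLt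
  fin_cases k
  · simp only [cwTight112, Fin.zero_eta, Matrix.cons_val_zero]
    rw [abs_of_nonneg (by positivity)]; exact_mod_cast (by omega : (p.1 : ℕ) ≤ 2)
  · simp only [cwTight112, Fin.mk_one, Matrix.cons_val_one, Matrix.cons_val_fin_one]
    rw [abs_of_nonneg (by positivity)]; exact_mod_cast (by omega : (p.2 : ℕ) ≤ 2)

/-- The tightness relation on `cwS112`. [folklore] -/
theorem cwTight112_sum (s : PL × PL × PL) (hs : s ∈ cwS112) (k : Fin 2) :
    cwTight112 s.1 k + cwTight112 s.2.1 k + cwTight112γ s.2.2 k = 0 := by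
  simp only [cwS112, Finset.mem_insert, Finset.mem_singleton] at hs
  rcases hs with rfl | rfl | rfl | rfl <;> fin_cases k <;> simp [cwTight112, cwTight112γ]

variable (K : Type u) [Field K] (q : ℕ)

/-- **The pair labels of the support of `T^{[112]}` lie in `cwS112`.** [cite: CoppersmithWinograd1990, §8] -/
theorem cwSqComp112_support (x y z : Fin (q + 2) × Fin (q + 2)) (h : cwSqComp K q 1 1 2 x y z ≠ 0) :
    (cwPairLev x, cwPairLev y, cwPairLev z) ∈ cwS112 := by
  have h' : (if cwLev2 x ∈ ({1} : Finset (Fin 5)) ∧ cwLev2 y ∈ ({1} : Finset (Fin 5)) ∧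
      cwLev2 z ∈ ({2} : Finset (Fin 5)) then bigCwSq K q x y z else 0) ≠ 0 := h
  clear h
  split_ifs at h' with hc
  · simp only [Finset.mem_singleton] at hc
    obtain ⟨hx, hy, hz⟩ := hc
    obtain ⟨h1, h2⟩ := bigCwSq_pairSupport K q x y z h'
    rw [mem_cwSupport₃] at h1 h2
    have ex := congrArg Fin.val hx; have ey := congrArg Fin.val hy; have ez := congrArg Fin.val hz
    simp only [coe_cwLevSum, cwLevel₃_val] at ex ey ez h1 h2
    simp only [Fin.isValue, Fin.val_one, Fin.val_two] at ex ey ez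
    have e : ∀ (a : Fin (q + 2)) (n : ℕ) (hn : n < 3), cwLevel a = n → cwLevel₃ a = ⟨n, hn⟩ :=
      fun a n hn h => Fin.ext h
    have hx1 : cwLevel x.1 = 0 ∨ cwLevel x.1 = 1 := by omega
    have hy1 : cwLevel y.1 = 0 ∨ cwLevel y.1 = 1 := by omega
    simp only [cwS112, Finset.mem_insert, Finset.mem_singleton, Prod.mk.injEq]
    rcases hx1 with hx1 | hx1 <;> rcases hy1 with hy1 | hy1
    · exact Or.inr (Or.inl ⟨⟨e _ 0 (by norm_num) hx1, e _ 1 (by norm_num) (by omega)⟩,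
        ⟨e _ 0 (by norm_num) hy1, e _ 1 (by norm_num) (by omega)⟩,
        ⟨e _ 2 (by norm_num) (by omega), e _ 0 (by norm_num) (by omega)⟩⟩)
    · exact Or.inr (Or.inr (Or.inr ⟨⟨e _ 0 (by norm_num) hx1, e _ 1 (by norm_num) (by omega)⟩,
        ⟨e _ 1 (by norm_num) hy1, e _ 0 (by norm_num) (by omega)⟩,
        ⟨e _ 1 (by norm_num) (by omega), e _ 1 (by norm_num) (by omega)⟩⟩))
    · exact Or.inr (Or.inr (Or.inl ⟨⟨e _ 1 (by norm_num) hx1, e _ 0 (by norm_num) (by omega)⟩,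
        ⟨e _ 0 (by norm_num) hy1, e _ 1 (by norm_num) (by omega)⟩,
        ⟨e _ 1 (by norm_num) (by omega), e _ 1 (by norm_num) (by omega)⟩⟩))
    · exact Or.inl ⟨⟨e _ 1 (by norm_num) hx1, e _ 0 (by norm_num) (by omega)⟩,
        ⟨e _ 1 (by norm_num) hy1, e _ 0 (by norm_num) (by omega)⟩,
        ⟨e _ 0 (by norm_num) (by omega), e _ 2 (by norm_num) (by omega)⟩⟩
  · exact absurd rfl h'

/-- The component values of the pair decomposition: `q^{ρ/3}` on the volume-`q` products,
`(q²)^{ρ/3}` on the volume-`q²` products (those with `z`-label `(1,1)`). [cite: CoppersmithWinograd1990, §8] -/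
def cwU112 (ρ : ℝ) (s : PL × PL × PL) : ℝ :=
  if s.2.2 = (1, 1) then (((q * q : ℕ) : ℝ)) ^ (ρ / 3) else ((q : ℕ) : ℝ) ^ (ρ / 3)

/-- **The values of the four products** (supermultiplicativity from the level-1 values).
[cite: CoppersmithWinograd1990, §8] -/
theorem hasLaserValue_cwS112 (hq : 1 ≤ q) (ρ : ℝ) (s : PL × PL × PL) (hs : s ∈ cwS112) :
    HasLaserValue ρ (symm3 (partSubtensor cwPairLev cwPairLev cwPairLev (cwSqComp K q 1 1 2)
      {s.1} {s.2.1} {s.2.2})) (cwU112 q ρ s ^ 3) := by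
  have h0 : (0 : ℝ) ≤ (((q : ℕ) : ℝ) ^ (ρ / 3)) ^ 3 := by positivity
  have hqq : (((q * q : ℕ) : ℝ) ^ (ρ / 3)) ^ 3 = (((q : ℕ) : ℝ) ^ (ρ / 3)) ^ 3 * (((q : ℕ) : ℝ) ^ (ρ / 3)) ^ 3 := by
    rw [← mul_pow, ← Real.mul_rpow (Nat.cast_nonneg _) (Nat.cast_nonneg _)]; push_cast; ring_nf
  simp only [cwS112, Finset.mem_insert, Finset.mem_singleton] at hs
  rcases hs with rfl | rfl | rfl | rfl
  · simp only [cwU112]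
    rw [cwSqComp_pair, if_pos (by refine ⟨?_, ?_, ?_⟩ <;> ext <;> simp), if_neg (by decide)]
    have h := (hasLaserValue_symm3_cwComp110 K q ρ).symm3_kronecker (hasLaserValue_symm3_cwComp002 K q ρ) h0
      zero_le_one
    rwa [mul_one] at h
  · simp only [cwU112]
    rw [cwSqComp_pair, if_pos (by refine ⟨?_, ?_, ?_⟩ <;> ext <;> simp), if_neg (by decide)]
    have h := (hasLaserValue_symm3_cwComp002 K q ρ).symm3_kronecker (hasLaserValue_symm3_cwComp110 K q ρ)
      zero_le_one h0
    rwa [one_mul] at h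
  · simp only [cwU112]
    rw [cwSqComp_pair, if_pos (by refine ⟨?_, ?_, ?_⟩ <;> ext <;> simp), if_true, hqq]
    exact (hasLaserValue_symm3_cwComp101 K q ρ).symm3_kronecker (hasLaserValue_symm3_cwComp011 K q ρ) h0 h0
  · simp only [cwU112]
    rw [cwSqComp_pair, if_pos (by refine ⟨?_, ?_, ?_⟩ <;> ext <;> simp), if_true, hqq]
    exact (hasLaserValue_symm3_cwComp011 K q ρ).symm3_kronecker (hasLaserValue_symm3_cwComp101 K q ρ) h0 h0

end Decomposition

/-! ## The distribution and its entropies -/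

section Distribution

/-- **Coppersmith–Winograd's distribution on the four products**: weight `σ/2` on each volume-`q²`
product, `(1−σ)/2` on each volume-`q` product. [cite: CoppersmithWinograd1990, §8] -/
def cwP112 (σ : ℝ) (s : PL × PL × PL) : ℝ :=
  if s ∈ cwS112 then (if s.2.2 = (1, 1) then σ / 2 else (1 - σ) / 2) else 0

variable (σ : ℝ)

/-- `cwP112 σ` vanishes off `cwS112`. [folklore] -/
theorem cwP112_eq_zero (s : PL × PL × PL) (hs : s ∉ cwS112) : cwP112 σ s = 0 := by
  simp [cwP112, hs]

/-- `cwP112 σ ≥ 0` for `σ ∈ [0,1]`. [folklore] -/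
theorem cwP112_nonneg (h0 : 0 ≤ σ) (h1 : σ ≤ 1) (s : PL × PL × PL) : 0 ≤ cwP112 σ s := by
  simp only [cwP112]
  split_ifs <;> linarith

/-- The four values. [folklore] -/
theorem cwP112_values :
    cwP112 σ ((1, 0), (1, 0), (0, 2)) = (1 - σ) / 2 ∧ cwP112 σ ((0, 1), (0, 1), (2, 0)) = (1 - σ) / 2 ∧
    cwP112 σ ((1, 0), (0, 1), (1, 1)) = σ / 2 ∧ cwP112 σ ((0, 1), (1, 0), (1, 1)) = σ / 2 := by
  refine ⟨?_, ?_, ?_, ?_⟩ <;> simp [cwP112, cwS112]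

/-- `∑ cwP112 σ = 1`. [folklore] -/
theorem sum_cwP112 : ∑ s, cwP112 σ s = 1 := by
  rw [← Finset.sum_subset (Finset.subset_univ cwS112) (fun s _ hs => cwP112_eq_zero σ s hs)]
  obtain ⟨e1, e2, e3, e4⟩ := cwP112_values σ
  simp only [cwS112]
  rw [Finset.sum_insert (by decide), Finset.sum_insert (by decide), Finset.sum_insert (by decide),
    Finset.sum_singleton, e1, e2, e3, e4]
  ring

/-- **The marginals**: `x`-labels `(1,0), (0,1)` with mass `1/2` each. [cite: CoppersmithWinograd1990, §8] -/
theorem marginalDist₁_cwP112 : marginalDist₁ (cwP112 σ) = fun x =>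
    if x = (1, 0) then 1 / 2 else if x = (0, 1) then 1 / 2 else 0 := by
  obtain ⟨e1, e2, e3, e4⟩ := cwP112_values σ
  funext x
  rw [marginalDist₁_eq_sum_filter cwS112 (cwP112_eq_zero σ)]
  obtain ⟨a, b⟩ := x
  fin_cases a <;> fin_cases b <;>
    simp [cwS112, Finset.filter_insert, Finset.filter_singleton, e1, e2, e3, e4] <;> ring

/-- `y`-labels `(1,0), (0,1)` with mass `1/2` each. [cite: CoppersmithWinograd1990, §8] -/
theorem marginalDist₂_cwP112 : marginalDist₂ (cwP112 σ) = fun y =>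
    if y = (1, 0) then 1 / 2 else if y = (0, 1) then 1 / 2 else 0 := by
  obtain ⟨e1, e2, e3, e4⟩ := cwP112_values σ
  funext y
  rw [marginalDist₂_eq_sum_filter cwS112 (cwP112_eq_zero σ)]
  obtain ⟨a, b⟩ := y
  fin_cases a <;> fin_cases b <;>
    simp [cwS112, Finset.filter_insert, Finset.filter_singleton, e1, e2, e3, e4] <;> ring

/-- `z`-labels `(0,2), (2,0)` with mass `(1−σ)/2` each and `(1,1)` with mass `σ`.
[cite: CoppersmithWinograd1990, §8] -/
theorem marginalDist₃_cwP112 : marginalDist₃ (cwP112 σ) = fun z =>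
    if z = (0, 2) then (1 - σ) / 2 else if z = (2, 0) then (1 - σ) / 2 else if z = (1, 1) then σ else 0 := by
  obtain ⟨e1, e2, e3, e4⟩ := cwP112_values σ
  funext z
  rw [marginalDist₃_eq_sum_filter cwS112 (cwP112_eq_zero σ)]
  obtain ⟨a, b⟩ := z
  fin_cases a <;> fin_cases b <;>
    simp [cwS112, Finset.filter_insert, Finset.filter_singleton, e1, e2, e3, e4]

/-- `H(x-marginal) = 1` bit. [cite: CoppersmithWinograd1990, §8] -/
theorem shannonEntropy_marginalDist₁_cwP112 : shannonEntropy (marginalDist₁ (cwP112 σ)) = 1 := by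
  rw [marginalDist₁_cwP112, shannonEntropy_def, Fintype.sum_prod_type]
  simp only [Fin.sum_univ_three]
  have hl : Real.log 2 ≠ 0 := (Real.log_pos one_lt_two).ne'
  simp [Real.negMulLog, Real.log_inv]
  field_simp
  norm_num

/-- `H(y-marginal) = 1` bit. [cite: CoppersmithWinograd1990, §8] -/
theorem shannonEntropy_marginalDist₂_cwP112 : shannonEntropy (marginalDist₂ (cwP112 σ)) = 1 := by
  rw [marginalDist₂_cwP112, shannonEntropy_def, Fintype.sum_prod_type]
  simp only [Fin.sum_univ_three]
  have hl : Real.log 2 ≠ 0 := (Real.log_pos one_lt_two).ne'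
  simp [Real.negMulLog, Real.log_inv]
  field_simp
  norm_num

/-- `H(z-marginal) = (2 η((1−σ)/2) + η(σ)) / ln 2` bits (`η = negMulLog`). [cite: CoppersmithWinograd1990, §8] -/
theorem shannonEntropy_marginalDist₃_cwP112 : shannonEntropy (marginalDist₃ (cwP112 σ)) =
    (2 * negMulLog ((1 - σ) / 2) + negMulLog σ) / Real.log 2 := by
  rw [marginalDist₃_cwP112, shannonEntropy_def, Fintype.sum_prod_type]
  simp only [Fin.sum_univ_three]
  simp
  ring

/-- **`Γ = 0`**: the distribution has product form (`1 · 1 · h(z)`). [cite: LeGall2014, Prop. 4.1] -/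
theorem maxEntropyPenalty_cwP112 (h0 : 0 < σ) (h1 : σ < 1) : maxEntropyPenalty cwS112 (cwP112 σ) = 0 := by
  refine maxEntropyPenalty_eq_zero_of_mul cwS112 ⟨cwP112_nonneg σ h0.le h1.le, sum_cwP112 σ⟩
    (cwP112_eq_zero σ) (fun _ => 1) (fun _ => 1)
    (fun z => if z = (1, 1) then σ / 2 else (1 - σ) / 2) (fun _ _ => one_pos) (fun _ _ => one_pos)
    (fun s _ => by split_ifs <;> linarith) fun s hs => ?_
  simp only [cwP112, if_pos hs, one_mul]

end Distribution

/-! ## The value of `[112]` -/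

section Value

variable (K : Type u) [Field K] (q : ℕ)

/-- **Coppersmith–Winograd 1990, §8: the value of `[112]`.**  For `q ≥ 1`, `σ ∈ (0,1)` and any `ρ`,
`V_ρ(T^{[112]})³ ≥ 2^{2 + H_Z(σ)} · (q^{(ρ/3)(1+σ)})³` in Le Gall's sense, where
`H_Z(σ) = (2η((1−σ)/2) + η(σ))/ln 2 = (1−σ) + H₂(σ)` bits; optimising `σ` gives the printed
`V([112]) = 2^{2/3} q^{ρ/3} (q^ρ + 2)^{1/3}`. [cite: CoppersmithWinograd1990, §8] -/
theorem hasLaserValue_symm3_cwSqComp112 (hq : 1 ≤ q) (ρ σ : ℝ) (h0 : 0 < σ) (h1 : σ < 1) :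
    HasLaserValue ρ (symm3 (cwSqComp K q 1 1 2))
      ((2 : ℝ) ^ (2 + (2 * negMulLog ((1 - σ) / 2) + negMulLog σ) / Real.log 2) *
        ((((q : ℕ) : ℝ) ^ (ρ / 3 * (1 + σ))) ^ 3)) := by
  have hq0 : (0 : ℝ) < (q : ℕ) := by exact_mod_cast hq
  have hu : ∀ s ∈ cwS112, 0 < cwU112 q ρ s := fun s _ => by
    simp only [cwU112]; split_ifs <;> positivity
  have h := laserMethodSym_hasLaserValue (cwSqComp K q 1 1 2) cwPairLev cwPairLev cwPairLev cwS112
    (cwSqComp112_support K q) cwTight112 cwTight112 cwTight112γ cwTight112_injective cwTight112_injective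
    cwTight112γ_injective cwTight112_bound cwTight112_bound
    (fun p k => by
      have h1 := p.1.isLt; have h2 := p.2.isLt
      fin_cases k
      · simp only [cwTight112γ, Fin.zero_eta, Matrix.cons_val_zero]
        rw [abs_le]; constructor <;> push_cast <;> omega
      · simp only [cwTight112γ, Fin.mk_one, Matrix.cons_val_one, Matrix.cons_val_fin_one]
        rw [abs_le]; constructor <;> push_cast <;> omega)
    cwTight112_sum (cwU112 q ρ) hu (hasLaserValue_cwS112 K q hq ρ) (cwP112 σ) (cwP112_nonneg σ h0.le h1.le)
    (sum_cwP112 σ) (cwP112_eq_zero σ)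
  rw [shannonEntropy_marginalDist₁_cwP112, shannonEntropy_marginalDist₂_cwP112,
    shannonEntropy_marginalDist₃_cwP112, maxEntropyPenalty_cwP112 σ h0 h1, mul_zero, sub_zero] at h
  -- the product of the values
  have hprod : ∏ s ∈ cwS112, cwU112 q ρ s ^ cwP112 σ s = ((q : ℕ) : ℝ) ^ (ρ / 3 * (1 + σ)) := by
    obtain ⟨e1, e2, e3, e4⟩ := cwP112_values σ
    simp only [cwS112]
    rw [Finset.prod_insert (by decide), Finset.prod_insert (by decide), Finset.prod_insert (by decide),
      Finset.prod_singleton, e1, e2, e3, e4]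
    simp only [cwU112, Prod.mk.injEq, if_true]
    rw [if_neg (by decide), if_neg (by decide)]
    set A : ℝ := ((q : ℕ) : ℝ) ^ (ρ / 3) with hA'
    have hA : 0 < A := Real.rpow_pos_of_pos hq0 _
    have hB : (((q * q : ℕ) : ℝ)) ^ (ρ / 3) = A * A := by
      rw [hA', ← Real.mul_rpow hq0.le hq0.le]; push_cast; rfl
    have m : ∀ x y : ℝ, A ^ x * A ^ y = A ^ (x + y) := fun x y => (Real.rpow_add hA x y).symm
    rw [hB, Real.mul_rpow hA.le hA.le, show ((q : ℕ) : ℝ) ^ (ρ / 3 * (1 + σ)) = A ^ (1 + σ) from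
      Real.rpow_mul hq0.le _ _]
    simp only [m]
    congr 1; ring
  rw [hprod, show (1 : ℝ) + 1 + (2 * negMulLog ((1 - σ) / 2) + negMulLog σ) / Real.log 2 =
    2 + (2 * negMulLog ((1 - σ) / 2) + negMulLog σ) / Real.log 2 by ring] at h
  exact h

/-- The value of `[121] = [112]_C`. [cite: CoppersmithWinograd1990, §8] -/
theorem hasLaserValue_symm3_cwSqComp121 (hq : 1 ≤ q) (ρ σ : ℝ) (h0 : 0 < σ) (h1 : σ < 1) :
    HasLaserValue ρ (symm3 (cwSqComp K q 1 2 1))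
      ((2 : ℝ) ^ (2 + (2 * negMulLog ((1 - σ) / 2) + negMulLog σ) / Real.log 2) *
        ((((q : ℕ) : ℝ) ^ (ρ / 3 * (1 + σ))) ^ 3)) := by
  rw [cwSqComp_rotate K q 1 1 2]
  exact (hasLaserValue_symm3_cwSqComp112 K q hq ρ σ h0 h1).symm3_rotate

/-- The value of `[211] = [121]_C`. [cite: CoppersmithWinograd1990, §8] -/
theorem hasLaserValue_symm3_cwSqComp211 (hq : 1 ≤ q) (ρ σ : ℝ) (h0 : 0 < σ) (h1 : σ < 1) :
    HasLaserValue ρ (symm3 (cwSqComp K q 2 1 1))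
      ((2 : ℝ) ^ (2 + (2 * negMulLog ((1 - σ) / 2) + negMulLog σ) / Real.log 2) *
        ((((q : ℕ) : ℝ) ^ (ρ / 3 * (1 + σ))) ^ 3)) := by
  rw [cwSqComp_rotate K q 1 2 1]
  exact (hasLaserValue_symm3_cwSqComp121 K q hq ρ σ h0 h1).symm3_rotate

end Value

end Literature.Computability.AlgebraicComplexity
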